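import Summits.QuantumFields.YangMills.Theorems.FluctuationComparisonRegPrIntLS2BetaSmallBondGaugeFluxDatumVortexGauge
import HarnessLib

/-!
# S2β · D-GUARD, UPPER SIDE — (W2′) THE `U(1)` PARITY FLOOR OF THE FLUX DATUM: on every torus `(ℤ∕N)^d` (`d ≥ 2`), EVERY abelian-valued gauge copy
# `u x = expPoint (t x·e₀)` of the uniform-flux datum of (W1) ✓`…SmallBondGaugeCurvatureFloor` (flux `0 < k`, `2k < N`) has a bond of arc `≥ π∕4` — at EVERY
# window `θ` and every volume; beside (W2) ✓`…FluxDatumVortexGauge` (an `SU(2)` gauge with every arc `≤ π²∕(ℓ−1)`): on this family the non-abelian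
# unwinding of the flux quanta is NECESSARY AND SUFFICIENT for small bonds

Cell `ym3-torus` (YM ladder rung R3 = continuum `SU(2)` Yang–Mills on the three-torus at fixed lattice data — a RUNG: NOT d = 4, NOT infinite volume,
NOT a mass gap, NOT Clay).  Width seat «width 8» `ym3-torus-px8` (gen 28, toron∕flux lineage ✓p826411 → px17 (W1) ✓p837971), FREE px helper on crux
`stmt-QuantumFields-20520`; `--kind proof --supports stmt-QuantumFields-20520 --as helper`, count-neutral, DEFINITION-FREE (0 `def`, 0 `instance`, 0 `notation`,
0 `sorry`, default heartbeats).  NAMED (W2) by the architect lineage (px17 g23, STATUS 2026-09-01T00:07:19Z «GO, WITH PRIORITY»).  Companion (W2′) of (W2) ✓p838776∕✓p838853∕✓p838898 (UV3-NODE §118 (3)(iii): the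
prose remark made kernel).

WHY.  UV3-NODE §116.3 «WHY `U(1)` CANNOT DO STAGE T»: in the (BG∞) gluing, the boundary loop of a class-110 block is, for `U(1)`-valued data, a loop whose
WINDING NUMBER is the abelian flux through the slice, and a winding loop has no filling at any Lipschitz price; in `SU(2)` the same loop bounds a disc through
`S³` (`π₁(S³) = 0`) at price `O(√θ)` — (W2) executes exactly that on the flux datum.  THIS FILE is the sharp kernel form of the obstruction on the same datum:
if every bond of an abelian gauge copy had arc `< π∕4`, every bond angle `a_b = t(b₋) + ψ_b − t(b₊)` (`ψ_b = x₀·φ` on `e₁`-bonds, `φ = 2πk∕N`) would lie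
within `π∕4` of `2πℤ`; around each `(e₀,e₁)`-plaquette the four REDUCED angles then sum to a number `≡ φ (mod 2π)` of modulus `< π`, i.e. to `φ` EXACTLY
(`0 < φ < π`); summing over ALL sites, the left side telescopes to `0` (the shifts `x ↦ x + e_μ` are bijections of the torus) while the right side is
`|sites|·φ > 0`.  So abelian gauges of this datum never go below `π∕4` — at any `θ`, however small — while (W2)'s `SU(2)` gauge goes to `0` like `√θ`.

WHAT IS PROVED (sorry-free; any `Params` with `2 ≤ d`, level `0`, `SU(2)`; the datum by (W1)'s displayed hypothesis BYTE FOR BYTE, no `def`).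
* §1 ★ `cos_norm_logVec_eq_re` (`cos ‖log g‖ = re q_g` — from `dist1 = 2 sin(arc∕2)` and `|q − 1|² = 2 − 2 re q`), `re_su2Quat_expPoint_smul` (`re q(expPoint(a·e₀)) = cos a`),
  ★ `exists_int_abs_sub_lt_of_arc_lt` (`‖log (expPoint (a·e₀))‖ < π∕4 ⇒ ∃ m, |a − 2πm| < π∕4`: `cos` decreasing on `[0, π]`, `m = round(a∕2π)`).
* §2 ★ `gaugeAct_abelian_fluxDatum_eq` — an abelian gauge copy of the flux datum is `expPoint (a_b·e₀)` bond by bond, `a_b = t(b₋) + ψ_b − t(b₊)`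
  (✓`expPoint_add_smul`, ✓`expPoint_smul_pow`).
* §3 `shift_injective`, `shift_shift_comm`, `sum_shift_eq` (the shift is a bijection of `Site P 0`: `∑ x, f (x + e_μ) = ∑ x, f x`), `exists_val_add_one_sub`
  (`((z+1).val − z.val : ℝ) = 1 − N·j`, `j ∈ {0,1}` on `ℤ∕N`).
* §4 ★★★ `forall_abelianGauge_exists_arc_ge` — (W2′): `2 ≤ P.d`, `0 < k`, `2k < N`, `V` = the flux datum, `t : Site P 0 → ℝ` ARBITRARY ⟹
  `∃ b, π∕4 ≤ ‖logVec (su2Quat (((fun x => expPoint (t x • e₀))•V) b))‖`.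
* §5 ★★★ `fluxDatum_abelian_floor_and_su2_gauge` — at `k·ℓ² = N`, `ℓ ≥ 2`: `(∀ t, ∃ b, π∕4 ≤ arc) ∧ (∃ u, ∀ b, arc ≤ π²∕(ℓ−1))` (this file ∧ (W2)
  ✓`fluxDatum_exists_gauge_forall_arc_le`); ★★ `forall_abelianGauge_exists_arc_ge_T3` (the floor on Bałaban's `F.P J`).
READING (domain sentence, desk RULING №115 (R5)): a NEGATIVE statement about ABELIAN-VALUED gauge copies of ONE datum; it refutes no landed declaration and supplies no
letter of the chain; it fixes by kernel why the (BG∞) road (§116) must be non-abelian at stage T.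

HONEST SCOPE.  Elementary trigonometry and `ZMod`∕`Finset` bookkeeping over landed kinematics (pub-ymgap ✓`K0UniformFluxConfig` via px17 ✓`…SmallBondGaugeCurvatureFloor`,
✓`…DistributedHolonomySU2.expPoint_add_smul`, px8 ✓`…ToronObstruction.expPoint_smul_pow`, lit ✓`T4ExpWindowSmallField`); nothing of Bałaban's renormalisation-group
analysis is asserted, proved or refuted ([Balaban1985RegularSpaces] Lemma 1 p.79 ∕ Thm 2 p.83 fix LOCAL small-bond gauges on cubes — consistent, not used);
`hsuppPlus`∕(BG∞) for general data UNPROVED (§116 plan: (G2) ✓p838762-class, (G3) ✓p838808, (G4) ✓p838857 ∕ ⧗pigeonhole, (G5) ✓p838790, (G6)–(G8) open); `hsupp`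
FALSE below the height floor by kernel ∕ OPEN above; GAP♯∘ (`stub_uniformFibreGapOrbit`), the five registered stubs (0∕5), S2β, crux 20520, 19936, 19200, `YM3TorusSU2` are
NOT proved; no registered stub is closed; rung R3 = `SU(2)` YM₃ on T³ at fixed lattice data — NOT d = 4, NOT infinite volume, NOT a mass gap, NOT Clay; the Yang–Mills mass
gap is NOT proved.  Axioms standard.
References: T. Bałaban, CMP **99** (1985) 75–102 [Balaban1985RegularSpaces] (Lemma 1 p.79, (1.29) p.81, Thm 2 p.83); CMP **98** (1985) 17–51 [Balaban1985Averaging]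
((8)–(9) pp.18–19: gauge transformations, plaquette variables).
-/

set_option autoImplicit false

noncomputable section

namespace Summit.QuantumFields.YangMills.Theorems.FluctuationComparisonRegPrIntLS2BetaSmallBondGaugeFluxDatumAbelianFloor

open scoped Real Quaternion
open Literature.MathematicalPhysics.QuantumLattice (su2Quat norm_su2Quat)
open Literature.MathematicalPhysics.QuantumFieldTheory.Balaban1983to89
open T4CubeChartGnomonic (SU2)
open T4HaarSU2ExpChart (imQuat imQuat_re expPoint expPoint_zero su2Quat_expPoint exp_imQuat_smul)
open T4ExpWindowSmallField (logVec norm_logVec_le_pi dist1_eq_two_mul_sin dist1_eq_norm_su2Quat_sub_one norm_sub_one_sq)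
open T3ContinuumYM3Torus (T3Family)
open Summit.QuantumFields.YangMills.Theorems.FluctuationComparisonRegPrIntLS2BetaSmallBondGaugeToronObstruction (expPoint_smul_pow)
open Summit.QuantumFields.YangMills.Theorems.FluctuationComparisonRegPrIntLS2BetaDistributedHolonomySU2 (expPoint_add_smul)
open Summit.QuantumFields.YangMills.Theorems.FluctuationComparisonRegPrIntLS2BetaSmallBondGaugeFluxDatumVortexGauge (fluxDatum_exists_gauge_forall_arc_le)

/-! ## §1 Chart facts: `cos(arc g) = re (q_g)`, the real part along the `e₀`-ray, and the reduction of an angle modulo `2π` -/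

/-- `cos ‖log g‖ = re (su2Quat g)`: the arc of `g ∈ SU(2)` and the real part of its quaternion (`dist1 g = 2 sin(arc∕2)`, `|q − 1|² = 2 − 2 re q`). [folklore] -/
theorem cos_norm_logVec_eq_re (g : SU2) : Real.cos ‖logVec (su2Quat g)‖ = (su2Quat g).re := by
  have h1 : dist1 g ^ 2 = 2 - 2 * (su2Quat g).re := by
    rw [dist1_eq_norm_su2Quat_sub_one, norm_sub_one_sq (norm_su2Quat g)]
  rw [dist1_eq_two_mul_sin, mul_pow, Real.sin_sq_eq_half_sub,
    show 2 * (‖logVec (su2Quat g)‖ / 2) = ‖logVec (su2Quat g)‖ by ring] at h1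
  linarith

/-- Along the `e₀`-ray the quaternion of `expPoint (a·e₀)` has real part `cos a`. [folklore] -/
theorem re_su2Quat_expPoint_smul (a : ℝ) :
    (su2Quat (expPoint (a • EuclideanSpace.single (0 : Fin 3) (1 : ℝ)))).re = Real.cos a := by
  rw [su2Quat_expPoint, exp_imQuat_smul (by rw [PiLp.norm_single, norm_one])]
  simp

/-- ★ An arc below `π∕4` along the `e₀`-ray forces the angle within `π∕4` of `2πℤ`: `‖log (expPoint (a·e₀))‖ < π∕4 ⇒ ∃ m, |a − 2πm| < π∕4`
(`cos a = cos arc > cos(π∕4)`; reduce by `m = round(a∕2π)`; `cos` is decreasing on `[0, π]`). [folklore] -/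
theorem exists_int_abs_sub_lt_of_arc_lt (a : ℝ)
    (h : ‖logVec (su2Quat (expPoint (a • EuclideanSpace.single (0 : Fin 3) (1 : ℝ))))‖ < π / 4) :
    ∃ m : ℤ, |a - m * (2 * π)| < π / 4 := by
  have hcos : Real.cos (π / 4) < Real.cos a := by
    rw [← re_su2Quat_expPoint_smul a, ← cos_norm_logVec_eq_re]
    exact Real.cos_lt_cos_of_nonneg_of_le_pi (norm_nonneg _) (by linarith [Real.pi_pos]) h
  refine ⟨round (a / (2 * π)), ?_⟩
  set a' := a - (round (a / (2 * π)) : ℝ) * (2 * π) with ha'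
  have hπ := Real.pi_pos
  have hround := abs_sub_round (a / (2 * π))
  have ha'le : |a'| ≤ π := by
    have : a' = (a / (2 * π) - round (a / (2 * π))) * (2 * π) := by rw [ha']; field_simp
    rw [this, abs_mul, abs_of_pos (by positivity : (0 : ℝ) < 2 * π)]
    nlinarith
  have hcos' : Real.cos (π / 4) < Real.cos |a'| := by rwa [Real.cos_abs, ha', Real.cos_sub_int_mul_two_pi]
  by_contra hge
  push Not at hge
  exact absurd (Real.cos_le_cos_of_nonneg_of_le_pi (by positivity) ha'le hge) (not_le.2 hcos')

/-! ## §2 The abelian gauge copy of the flux datum, bond by bond -/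

section Datum

variable {P : Params}

/-- ★ **AN ABELIAN GAUGE OF THE FLUX DATUM IS ABELIAN BOND BY BOND**: with `u x = expPoint (t x·e₀)` every gauged bond is `expPoint (a_b·e₀)`,
`a_b = t(b₋) + ψ_b − t(b₊)`, `ψ_b = x₀·(2πk∕N)` on `e₁`-bonds and `0` elsewhere. [cite: Balaban1985Averaging, (8) p.19] -/
theorem gaugeAct_abelian_fluxDatum_eq (hd : 2 ≤ P.d) (k : ℕ) {V : GaugeField P 0 SU2}
    (hV : ∀ b, V b = if b.dir = (⟨1, hd⟩ : Fin P.d) then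
      expPoint ((2 * π * k / (P.sitesPerDir 0 : ℝ)) • EuclideanSpace.single (0 : Fin 3) (1 : ℝ)) ^ (b.src ⟨0, by omega⟩).val else 1)
    (t : Site P 0 → ℝ) (b : PBond P 0) :
    GaugeField.gaugeAct (fun x => expPoint (t x • EuclideanSpace.single (0 : Fin 3) (1 : ℝ))) V b
      = expPoint ((t b.src + (if b.dir = (⟨1, hd⟩ : Fin P.d) then ((b.src ⟨0, by omega⟩).val : ℝ) * (2 * π * k / (P.sitesPerDir 0 : ℝ)) else 0)
          - t b.tgt) • EuclideanSpace.single (0 : Fin 3) (1 : ℝ)) := by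
  set e : EuclideanSpace ℝ (Fin 3) := EuclideanSpace.single (0 : Fin 3) (1 : ℝ)
  have hinv : ∀ s : ℝ, (expPoint (s • e))⁻¹ = expPoint ((-s) • e) := fun s => by
    rw [eq_comm, eq_inv_iff_mul_eq_one, ← expPoint_add_smul, neg_add_cancel, zero_smul, expPoint_zero]
  have hVb : V b = expPoint ((if b.dir = (⟨1, hd⟩ : Fin P.d) then ((b.src ⟨0, by omega⟩).val : ℝ) * (2 * π * k / (P.sitesPerDir 0 : ℝ))
      else 0) • e) := by
    rw [hV]
    split_ifs
    · rw [expPoint_smul_pow]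
    · rw [zero_smul, expPoint_zero]
  rw [GaugeField.gaugeAct, hVb, hinv, ← expPoint_add_smul, ← expPoint_add_smul, ← sub_eq_add_neg]

end Datum

/-! ## §3 Lattice facts: the shift is a bijection, shifts commute, the successor coordinate -/

section Lattice

variable {P : Params}

/-- The shift `x ↦ x + e_μ` is injective. [folklore] -/
theorem shift_injective (μ : Fin P.d) : Function.Injective fun x : Site P 0 => x.shift μ := by
  intro x y h
  funext ν
  have hν := congrFun h ν
  by_cases hνμ : ν = μ
  · subst hνμ
    simp only [Site.shift, Function.update_self] at hν
    exact add_right_cancel hν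
  · simpa only [Site.shift, Function.update_of_ne hνμ] using hν

/-- Shifts in two different directions commute. [folklore] -/
theorem shift_shift_comm {μ ν : Fin P.d} (h : μ ≠ ν) (x : Site P 0) : (x.shift μ).shift ν = (x.shift ν).shift μ := by
  simp only [Site.shift, Function.update_of_ne h, Function.update_of_ne (Ne.symm h)]
  exact Function.update_comm h _ _ _

/-- Summing a function over all sites is invariant under a shift of the argument. [folklore] -/
theorem sum_shift_eq (μ : Fin P.d) (f : Site P 0 → ℝ) : ∑ x : Site P 0, f (x.shift μ) = ∑ x, f x :=
  Equiv.sum_comp (Equiv.ofBijective _ (shift_injective μ).bijective_of_finite) f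

/-- The successor coordinate on the cycle `ℤ∕N` (`N ≥ 2`): `((z + 1).val : ℝ) − z.val ∈ {1, 1 − N}`, i.e. `= 1 − N·j` with `j ∈ {0, 1}`. [folklore] -/
theorem exists_val_add_one_sub (N : ℕ) [NeZero N] (hN : 1 < N) (z : ZMod N) :
    ∃ j : ℤ, (((z + 1).val : ℕ) : ℝ) - (z.val : ℝ) = 1 - (N : ℝ) * j := by
  haveI : Fact (1 < N) := ⟨hN⟩
  have hlt := ZMod.val_lt z
  rw [ZMod.val_add, ZMod.val_one]
  rcases Nat.lt_or_ge (z.val + 1) N with h | h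
  · refine ⟨0, ?_⟩
    rw [Nat.mod_eq_of_lt h]; push_cast; ring
  · have hz : z.val + 1 = N := by omega
    refine ⟨1, ?_⟩
    rw [hz, Nat.mod_self]
    have : (z.val : ℝ) = N - 1 := by
      have h' : ((z.val + 1 : ℕ) : ℝ) = N := by exact_mod_cast hz
      push_cast at h'; linarith
    rw [this]; push_cast; ring

end Lattice

/-! ## §4 (W2′) THE `U(1)` PARITY FLOOR: every abelian gauge copy of the flux datum has a bond arc `≥ π∕4` -/

/-- ★★★ **(W2′) THE `U(1)` PARITY FLOOR OF THE FLUX DATUM**: on any torus `(ℤ∕N)^d` (`d ≥ 2`), let `V` be the uniform-flux datum of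
✓`…SmallBondGaugeCurvatureFloor` §2 at a flux `0 < k` with `2k < N` (plaquette angle `φ = 2πk∕N ∈ (0, π)`).  Then for EVERY abelian-valued gauge
`u x = expPoint (t x·e₀)` (`t` arbitrary) SOME bond of `u•V` has arc `≥ π∕4` — at every window `θ` and every volume.  Proof: if all arcs were `< π∕4`,
every bond angle `a_b = t(b₋) + ψ_b − t(b₊)` would lie within `π∕4` of `2πℤ` (§1); around each `(e₀,e₁)`-plaquette the four reduced angles sum to a
number `≡ φ (mod 2π)` of modulus `< π`, hence `= φ` exactly; summing over ALL sites the left side telescopes to `0` (the shifts are bijections) while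
the right side is `|sites|·φ > 0`.  With (W2) ✓`…FluxDatumVortexGauge.fluxDatum_exists_gauge_forall_bond_le` (`SU(2)` gauge, every bond `≤ 2π∕(ℓ−1)`)
on the same datum: the non-abelian unwinding is NECESSARY AND SUFFICIENT for the `√θ` law on this family.
[cite: Balaban1985Averaging, (8)-(9) pp.18-19 (gauge transformations and plaquette variables); Balaban1985RegularSpaces, Lemma 1 p.79] -/
theorem forall_abelianGauge_exists_arc_ge {P : Params} (hd : 2 ≤ P.d) {k : ℕ} (hk : 0 < k) (h2k : 2 * k < P.sitesPerDir 0)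
    {V : GaugeField P 0 SU2}
    (hV : ∀ b, V b = if b.dir = (⟨1, hd⟩ : Fin P.d) then
      expPoint ((2 * π * k / (P.sitesPerDir 0 : ℝ)) • EuclideanSpace.single (0 : Fin 3) (1 : ℝ)) ^ (b.src ⟨0, by omega⟩).val else 1)
    (t : Site P 0 → ℝ) :
    ∃ b : PBond P 0, π / 4 ≤
      ‖logVec (su2Quat (GaugeField.gaugeAct (fun x => expPoint (t x • EuclideanSpace.single (0 : Fin 3) (1 : ℝ))) V b))‖ := by
  by_contra hcon
  push Not at hcon
  -- notation
  set N := P.sitesPerDir 0 with hNdef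
  set e0 : Fin P.d := ⟨0, by omega⟩ with he0
  set e1 : Fin P.d := ⟨1, hd⟩ with he1
  have h01 : e0 ≠ e1 := by rw [he0, he1]; simp [Fin.ext_iff]
  set φ : ℝ := 2 * π * k / (N : ℝ) with hφ
  have hNpos : (0 : ℝ) < N := by exact_mod_cast (show 0 < N by omega)
  have hkpos : (0 : ℝ) < k := by exact_mod_cast hk
  have hφpos : 0 < φ := by rw [hφ]; positivity
  have hφlt : φ < π := by
    rw [hφ, div_lt_iff₀ hNpos]
    have : (2 * k : ℝ) < N := by exact_mod_cast h2k
    nlinarith [Real.pi_pos]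
  have hφN : φ * N = 2 * π * k := by rw [hφ]; field_simp
  -- the bond angles and their reductions modulo `2π`
  let ψ : PBond P 0 → ℝ := fun b => if b.dir = e1 then ((b.src e0).val : ℝ) * φ else 0
  let a : PBond P 0 → ℝ := fun b => t b.src + ψ b - t b.tgt
  have ha : ∀ b, GaugeField.gaugeAct (fun x => expPoint (t x • EuclideanSpace.single (0 : Fin 3) (1 : ℝ))) V b
      = expPoint (a b • EuclideanSpace.single (0 : Fin 3) (1 : ℝ)) := fun b => gaugeAct_abelian_fluxDatum_eq hd k hV t b
  have hm : ∀ b, ∃ m : ℤ, |a b - m * (2 * π)| < π / 4 := fun b =>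
    exists_int_abs_sub_lt_of_arc_lt (a b) (by rw [← ha b]; exact hcon b)
  choose m hm using hm
  let α : PBond P 0 → ℝ := fun b => a b - m b * (2 * π)
  have hα : ∀ b, |α b| < π / 4 := hm
  -- the plaquette identity: around each `(e₀,e₁)`-plaquette the reduced angles sum to `φ` EXACTLY
  have hplaq : ∀ x : Site P 0,
      α ⟨x, e0⟩ + α ⟨x.shift e0, e1⟩ - α ⟨x.shift e1, e0⟩ - α ⟨x, e1⟩ = φ := by
    intro x
    -- the unreduced angles: the `t`'s telescope, the `ψ`'s give `φ·((x₀+1).val − x₀.val) = φ − φN·j`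
    obtain ⟨j, hj⟩ := exists_val_add_one_sub N (by omega) (x e0)
    have hsrc1 : (x.shift e0) e0 = x e0 + 1 := by simp [Site.shift]
    have hsrc2 : (x.shift e1) e0 = x e0 := by simp [Site.shift, Function.update_of_ne h01]
    have htgt : (x.shift e0).shift e1 = (x.shift e1).shift e0 := shift_shift_comm h01 x
    have hraw : a ⟨x, e0⟩ + a ⟨x.shift e0, e1⟩ - a ⟨x.shift e1, e0⟩ - a ⟨x, e1⟩ = φ - 2 * π * k * j := by
      simp only [a, ψ, PBond.tgt, if_neg h01, if_true, hsrc1, hsrc2, htgt, add_zero]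
      have : (((x e0 + 1).val : ℕ) : ℝ) * φ - ((x e0).val : ℝ) * φ = φ - 2 * π * k * j := by
        rw [← sub_mul, hj, ← hφN]; ring
      linarith
    -- the reduced sum differs from `φ` by `2π·(integer)` and has modulus `< π`
    have hint : α ⟨x, e0⟩ + α ⟨x.shift e0, e1⟩ - α ⟨x.shift e1, e0⟩ - α ⟨x, e1⟩
        = φ + ((-(k : ℤ) * j - m ⟨x, e0⟩ - m ⟨x.shift e0, e1⟩ + m ⟨x.shift e1, e0⟩ + m ⟨x, e1⟩ : ℤ) : ℝ) * (2 * π) := by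
      simp only [α]; push_cast; linarith
    -- the integer is opaque from here on
    generalize hM : (-(k : ℤ) * j - m ⟨x, e0⟩ - m ⟨x.shift e0, e1⟩ + m ⟨x.shift e1, e0⟩ + m ⟨x, e1⟩ : ℤ) = M at hint
    have habs : |φ + (M : ℝ) * (2 * π)| < π := by
      rw [← hint]
      have h1 := hα ⟨x, e0⟩; have h2 := hα ⟨x.shift e0, e1⟩; have h3 := hα ⟨x.shift e1, e0⟩; have h4 := hα ⟨x, e1⟩
      rw [abs_lt] at h1 h2 h3 h4 ⊢
      constructor <;> linarith
    -- `|φ + 2πM| < π` with `0 < φ < π` forces `M = 0`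
    have hM0 : (M : ℝ) = 0 := by
      rw [abs_lt] at habs
      have h2π : (0 : ℝ) ≤ 2 * π := by positivity
      rcases lt_trichotomy M 0 with hneg | hzero | hpos
      · have hM1 : (M : ℝ) ≤ -1 := by exact_mod_cast Int.le_sub_one_iff.mpr hneg
        have := mul_le_mul_of_nonneg_right hM1 h2π
        linarith
      · exact_mod_cast hzero
      · have hM1 : (1 : ℝ) ≤ M := by exact_mod_cast hpos
        have := mul_le_mul_of_nonneg_right hM1 h2π
        linarith
    rw [hint, hM0]; ring
  -- summing over all sites: the left side telescopes to `0`, the right side is `|sites|·φ > 0`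
  have hsum : ∑ x : Site P 0, (α ⟨x, e0⟩ + α ⟨x.shift e0, e1⟩ - α ⟨x.shift e1, e0⟩ - α ⟨x, e1⟩) = 0 := by
    simp only [Finset.sum_add_distrib, Finset.sum_sub_distrib]
    rw [sum_shift_eq e0 (fun y => α ⟨y, e1⟩), sum_shift_eq e1 (fun y => α ⟨y, e0⟩)]
    ring
  have hsum' : ∑ x : Site P 0, (α ⟨x, e0⟩ + α ⟨x.shift e0, e1⟩ - α ⟨x.shift e1, e0⟩ - α ⟨x, e1⟩)
      = Fintype.card (Site P 0) * φ := by
    rw [Finset.sum_congr rfl fun x _ => hplaq x, Finset.sum_const, Finset.card_univ, nsmul_eq_mul]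
  have hcard : (0 : ℝ) < Fintype.card (Site P 0) := by
    exact_mod_cast Fintype.card_pos_iff.mpr ⟨default⟩
  have : (0 : ℝ) < Fintype.card (Site P 0) * φ := mul_pos hcard hφpos
  linarith

/-! ## §5 `U(1)` versus `SU(2)` on one datum; Bałaban's three-tori -/

/-- ★★★ **ABELIAN VERSUS NON-ABELIAN GAUGES OF ONE DATUM**: for the flux datum at `k·ℓ² = N`, `ℓ ≥ 2` (so `0 < k`, `2k < N`): EVERY abelian-valued gauge
copy has a bond of arc `≥ π∕4` (this file), while SOME `SU(2)`-valued gauge copy has EVERY bond of arc `≤ π²∕(ℓ−1)` ((W2) ✓`…FluxDatumVortexGauge`) — on this family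
the non-abelian unwinding of the flux quanta is necessary and sufficient for small bonds, uniformly in the volume `N ∈ ℓ²·ℕ`.
[cite: Balaban1985RegularSpaces, Lemma 1 p.79, Thm 2 p.83 (print's small-bond gauges are local); Balaban1985Averaging, (8)-(9) pp.18-19] -/
theorem fluxDatum_abelian_floor_and_su2_gauge {P : Params} (hd : 2 ≤ P.d) {ℓ k : ℕ} (hℓ : 2 ≤ ℓ)
    (hk : k * ℓ ^ 2 = P.sitesPerDir 0) {V : GaugeField P 0 SU2}
    (hV : ∀ b, V b = if b.dir = (⟨1, hd⟩ : Fin P.d) then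
      expPoint ((2 * π * k / (P.sitesPerDir 0 : ℝ)) • EuclideanSpace.single (0 : Fin 3) (1 : ℝ)) ^ (b.src ⟨0, by omega⟩).val else 1) :
    (∀ t : Site P 0 → ℝ, ∃ b : PBond P 0, π / 4 ≤
        ‖logVec (su2Quat (GaugeField.gaugeAct (fun x => expPoint (t x • EuclideanSpace.single (0 : Fin 3) (1 : ℝ))) V b))‖) ∧
    (∃ u : GaugeTransf P 0 SU2, ∀ b : PBond P 0, ‖logVec (su2Quat (GaugeField.gaugeAct u V b))‖ ≤ π ^ 2 / ((ℓ : ℝ) - 1)) := by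
  have hNpos : 0 < P.sitesPerDir 0 := Nat.pos_of_ne_zero (P.sitesPerDir_ne_zero 0)
  have hk0 : 0 < k := Nat.pos_of_ne_zero fun h => by rw [h, zero_mul] at hk; exact hNpos.ne' hk.symm
  have h2k : 2 * k < P.sitesPerDir 0 := by
    rw [← hk]
    have : 2 < ℓ ^ 2 := by nlinarith
    nlinarith
  refine ⟨fun t => forall_abelianGauge_exists_arc_ge hd hk0 h2k hV t, ?_⟩
  obtain ⟨u, hu⟩ := fluxDatum_exists_gauge_forall_arc_le hd hℓ hk hV
  exact ⟨u, fun b => (hu b).2⟩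

/-- ★★ **THE `U(1)` PARITY FLOOR ON BAŁABAN's THREE-TORI**: for every family `F`, height `J`, flux `0 < k` with `2k < N_J`, and every abelian-valued gauge,
the flux datum on `F.P J` has a gauged bond of arc `≥ π∕4`. [cite: Balaban1985RegularSpaces, Lemma 1 p.79] -/
theorem forall_abelianGauge_exists_arc_ge_T3 (F : T3Family) (J : ℕ) {k : ℕ} (hk : 0 < k) (h2k : 2 * k < (F.P J).sitesPerDir 0)
    {V : GaugeField (F.P J) 0 SU2}
    (hV : ∀ b, V b = if b.dir = (⟨1, by rw [T3Family.P_d]; norm_num⟩ : Fin (F.P J).d) then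
      expPoint ((2 * π * k / ((F.P J).sitesPerDir 0 : ℝ)) • EuclideanSpace.single (0 : Fin 3) (1 : ℝ))
        ^ (b.src ⟨0, by rw [T3Family.P_d]; norm_num⟩).val else 1)
    (t : Site (F.P J) 0 → ℝ) :
    ∃ b : PBond (F.P J) 0, π / 4 ≤
      ‖logVec (su2Quat (GaugeField.gaugeAct (fun x => expPoint (t x • EuclideanSpace.single (0 : Fin 3) (1 : ℝ))) V b))‖ :=
  forall_abelianGauge_exists_arc_ge (P := F.P J) (by rw [T3Family.P_d]; norm_num) hk h2k hV t

end Summit.QuantumFields.YangMills.Theorems.FluctuationComparisonRegPrIntLS2BetaSmallBondGaugeFluxDatumAbelianFloor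

end
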